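import Mathlib
import Literature.MathematicalPhysics.QuantumLattice.LatticeScalarField
import HarnessLib

/-!
# `PencilRigidity.NPointIsotropy`, line `complex-rotation-bandlimit`: Riemann sums over exploding fine boxes

Stub `riemannSumBox` of crux `stmt-QuantumFields-11686`
(`Summit.QuantumFields.YangMills.Theses.PencilRigidity.NPointIsotropy`), line `complex-rotation-bandlimit`
(lead c1, gen 5). Elementary real analysis over Mathlib; the only tree vocabulary is the lattice box
`box d L = {-L, …, L}ᵈ ⊆ ℤᵈ` and the site embedding `siteToE : ℤᵈ → ℝᵈ`. No definitions and no notation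
are introduced: the floor site `(⌊xᵢ / a⌋)ᵢ` and the half-open cell
`{z | ∀ i, zᵢ ∈ [a yᵢ, a yᵢ + a)}` are written out as explicit Mathlib terms throughout.

Informal statement. For a Schwartz function `g` on `ℝ⁴`, lattice spacings `a_k > 0` with `a_k → 0` and
half-sides `L_k ∈ ℕ` with `a_k L_k → ∞`, the Riemann sums over the fine boxes converge to the Lebesgue
integral: `a_k⁴ Σ_{y ∈ {-L_k,…,L_k}⁴} g(a_k y) → ∫ g`.

Proof (dominated convergence, any dimension `d`). The Riemann sum is the integral of the step function
`s_k = Σ_{y ∈ box} g(a_k y) 1_{C_k(y)}` with the half-open cells `C_k(y) = Πᵢ [a_k yᵢ, a_k yᵢ + a_k)` of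
volume `a_k^d` (product Lebesgue measure transported along `EuclideanSpace ℝ (Fin d) → (Fin d → ℝ)`,
`PiLp.volume_preserving_ofLp`). A point `x` lies in exactly one cell, the one of `y = ⌊x / a_k⌋`
(coordinatewise), and `‖x - a_k y‖ ≤ d a_k`; hence `s_k(x) = g(a_k ⌊x/a_k⌋) → g(x)` (continuity of `g`; the
site `⌊x/a_k⌋` lies in the box as soon as `a_k L_k ≥ ‖x‖`), and for `a_k ≤ 1` the Schwartz decay
`(1 + ‖z‖)^{d+1} |g z| ≤ M` gives the integrable majorant `|s_k(x)| ≤ M (d+1)^{d+1} (1 + ‖x‖)^{-(d+1)}`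
(`integrable_one_add_norm`). References: folklore (J. Glimm, A. Jaffe, Quantum Physics (1987) §9.5–9.6,
lattice approximation and Riemann sums of test functions). [folklore]
-/

noncomputable section

open scoped SchwartzMap
open MeasureTheory Filter Topology
open Literature.Probability.LatticeModels (box mem_box Site)
open Literature.MathematicalPhysics.QuantumLattice (siteToE siteToE_apply)

namespace Summit.QuantumFields.YangMills.Theorems.NPointIsotropy.ComplexRotationBandlimit

variable {d : ℕ}

/-! ## Lattice cells `{z | ∀ i, zᵢ ∈ [a yᵢ, a yᵢ + a)}` of mesh `a` and floor sites `(⌊xᵢ / a⌋)ᵢ` -/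

/-- A point lies in the cell of `y` iff its coordinatewise floor site is `y` (mesh `a > 0`). [folklore] -/
theorem mem_cell_iff {a : ℝ} (ha : 0 < a) {y : Site d} {x : EuclideanSpace ℝ (Fin d)} :
    x ∈ {z : EuclideanSpace ℝ (Fin d) | ∀ i, z i ∈ Set.Ico (a * (y i : ℝ)) (a * (y i : ℝ) + a)} ↔
      (fun i => ⌊x i / a⌋) = y := by
  simp only [Set.mem_setOf_eq, Set.mem_Ico, funext_iff, Int.floor_eq_iff, le_div_iff₀ ha,
    div_lt_iff₀ ha]
  refine forall_congr' fun i => ?_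
  constructor <;> rintro ⟨h1, h2⟩ <;> constructor <;> linarith

/-- Every point lies in the cell of its floor site. [folklore] -/
theorem mem_cell_floor {a : ℝ} (ha : 0 < a) (x : EuclideanSpace ℝ (Fin d)) :
    x ∈ {z : EuclideanSpace ℝ (Fin d) |
      ∀ i, z i ∈ Set.Ico (a * ((⌊x i / a⌋ : ℤ) : ℝ)) (a * ((⌊x i / a⌋ : ℤ) : ℝ) + a)} :=
  (mem_cell_iff ha (y := fun i => ⌊x i / a⌋)).2 rfl

/-- The cell is the preimage of a product of half-open intervals under the coordinate map. [folklore] -/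
theorem cell_eq_preimage (a : ℝ) (y : Site d) :
    {z : EuclideanSpace ℝ (Fin d) | ∀ i, z i ∈ Set.Ico (a * (y i : ℝ)) (a * (y i : ℝ) + a)} =
      (WithLp.ofLp : EuclideanSpace ℝ (Fin d) → (Fin d → ℝ)) ⁻¹'
        Set.pi Set.univ (fun i => Set.Ico (a * (y i : ℝ)) (a * (y i : ℝ) + a)) := by
  ext z
  simp

/-- Cells are measurable. [folklore] -/
theorem measurableSet_cell (a : ℝ) (y : Site d) :
    MeasurableSet {z : EuclideanSpace ℝ (Fin d) | ∀ i, z i ∈ Set.Ico (a * (y i : ℝ)) (a * (y i : ℝ) + a)} := by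
  rw [cell_eq_preimage]
  exact (MeasurableSet.univ_pi fun _ => measurableSet_Ico).preimage
    (PiLp.volume_preserving_ofLp (Fin d)).measurable

/-- The Lebesgue volume of a cell of mesh `a ≥ 0` is `a^d`. [folklore] -/
theorem volume_cell {a : ℝ} (ha : 0 ≤ a) (y : Site d) :
    volume {z : EuclideanSpace ℝ (Fin d) | ∀ i, z i ∈ Set.Ico (a * (y i : ℝ)) (a * (y i : ℝ) + a)} =
      ENNReal.ofReal (a ^ d) := by
  rw [cell_eq_preimage, (PiLp.volume_preserving_ofLp (Fin d)).measure_preimage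
      (MeasurableSet.univ_pi fun _ => measurableSet_Ico).nullMeasurableSet, Real.volume_pi_Ico,
    ENNReal.ofReal_pow ha]
  simp

/-- Coordinates of a point differ from those of its scaled floor site by at most the mesh. [folklore] -/
theorem abs_sub_floor_le {a : ℝ} (ha : 0 < a) (x : EuclideanSpace ℝ (Fin d)) (i : Fin d) :
    |x i - a * ((⌊x i / a⌋ : ℤ) : ℝ)| ≤ a := by
  have h := mem_cell_floor ha x
  simp only [Set.mem_setOf_eq, Set.mem_Ico] at h
  obtain ⟨h1, h2⟩ := h i
  rw [abs_le]
  constructor <;> linarith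

/-- Euclidean norm from coordinate bounds: `|vᵢ| ≤ c` for all `i` gives `‖v‖ ≤ d c`. [folklore] -/
theorem norm_le_of_forall_abs_le {v : EuclideanSpace ℝ (Fin d)} {c : ℝ} (hc : 0 ≤ c)
    (h : ∀ i, |v i| ≤ c) : ‖v‖ ≤ d * c := by
  have hd : (d : ℝ) ≤ (d : ℝ) ^ 2 := by exact_mod_cast Nat.le_self_pow two_ne_zero d
  have hsq : ‖v‖ ^ 2 ≤ (d * c) ^ 2 := by
    rw [EuclideanSpace.real_norm_sq_eq]
    calc ∑ i, v i ^ 2 ≤ ∑ _i : Fin d, c ^ 2 := Finset.sum_le_sum fun i _ => by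
            rw [← sq_abs]
            exact pow_le_pow_left₀ (abs_nonneg _) (h i) 2
      _ = d * c ^ 2 := by simp
      _ ≤ (d : ℝ) ^ 2 * c ^ 2 := mul_le_mul_of_nonneg_right hd (sq_nonneg c)
      _ = (d * c) ^ 2 := by ring
  exact (sq_le_sq₀ (norm_nonneg _) (by positivity)).1 hsq

/-- A point is within `d a` of its scaled floor site. [folklore] -/
theorem norm_sub_floor_le {a : ℝ} (ha : 0 < a) (x : EuclideanSpace ℝ (Fin d)) :
    ‖x - a • siteToE (fun i => ⌊x i / a⌋)‖ ≤ d * a :=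
  norm_le_of_forall_abs_le ha.le fun i => by
    rw [PiLp.sub_apply, PiLp.smul_apply, siteToE_apply, smul_eq_mul]
    exact abs_sub_floor_le ha x i

/-- As the mesh tends to zero the scaled floor sites of `x` tend to `x`. [folklore] -/
theorem tendsto_smul_floor {a : ℕ → ℝ} (ha : ∀ k, 0 < a k) (ha0 : Tendsto a atTop (𝓝 0))
    (x : EuclideanSpace ℝ (Fin d)) :
    Tendsto (fun k => a k • siteToE (fun i => ⌊x i / a k⌋)) atTop (𝓝 x) := by
  rw [tendsto_iff_norm_sub_tendsto_zero]
  refine squeeze_zero (g := fun k => (d : ℝ) * a k) (fun k => norm_nonneg _) (fun k => ?_) ?_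
  · rw [norm_sub_rev]
    exact norm_sub_floor_le (ha k) x
  · simpa using ha0.const_mul (d : ℝ)

/-- If `a_k L_k → ∞` then the floor site of `x` at mesh `a_k` eventually lies in `box d L_k`. [folklore] -/
theorem eventually_floor_mem_box {a : ℕ → ℝ} {L : ℕ → ℕ} (ha : ∀ k, 0 < a k)
    (haL : Tendsto (fun k => a k * L k) atTop atTop) (x : EuclideanSpace ℝ (Fin d)) :
    ∀ᶠ k in atTop, (fun i => ⌊x i / a k⌋) ∈ box d (L k) := by
  filter_upwards [haL.eventually_ge_atTop ‖x‖] with k hk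
  rw [mem_box]
  intro i
  have hxi : |x i| ≤ a k * L k := by
    have h := PiLp.norm_apply_le x i
    rw [Real.norm_eq_abs] at h
    exact h.trans hk
  rw [abs_le] at hxi
  constructor
  · rw [Int.le_floor, Int.cast_neg, Int.cast_natCast, le_div_iff₀ (ha k)]
    linarith
  · have h : (⌊x i / a k⌋ : ℝ) ≤ (L k : ℝ) :=
      (Int.floor_le _).trans (by rw [div_le_iff₀ (ha k)]; linarith)
    exact_mod_cast h

/-! ## The lattice step function `Σ_{y ∈ box d L} g(a y) 1_{cell(a, y)}` -/

/-- A constant on a cell is integrable. [folklore] -/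
theorem integrable_cell_indicator {a : ℝ} (ha : 0 ≤ a) (y : Site d) (c : ℝ) :
    Integrable ({z : EuclideanSpace ℝ (Fin d) |
      ∀ i, z i ∈ Set.Ico (a * (y i : ℝ)) (a * (y i : ℝ) + a)}.indicator fun _ => c) volume :=
  (integrableOn_const (by rw [volume_cell ha]; exact ENNReal.ofReal_ne_top)).integrable_indicator
    (measurableSet_cell a y)

/-- The lattice step function is integrable. [folklore] -/
theorem integrable_step (g : EuclideanSpace ℝ (Fin d) → ℝ) {a : ℝ} (ha : 0 ≤ a) (L : ℕ) :
    Integrable (fun x : EuclideanSpace ℝ (Fin d) => ∑ y ∈ box d L, {z : EuclideanSpace ℝ (Fin d) |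
      ∀ i, z i ∈ Set.Ico (a * (y i : ℝ)) (a * (y i : ℝ) + a)}.indicator (fun _ => g (a • siteToE y)) x)
      volume :=
  integrable_finsetSum _ fun y _ => integrable_cell_indicator ha y _

/-- The integral of the lattice step function is the Riemann sum `a^d Σ_{y ∈ box d L} g(a y)`. [folklore] -/
theorem integral_step (g : EuclideanSpace ℝ (Fin d) → ℝ) {a : ℝ} (ha : 0 ≤ a) (L : ℕ) :
    ∫ x : EuclideanSpace ℝ (Fin d), ∑ y ∈ box d L, {z : EuclideanSpace ℝ (Fin d) |
      ∀ i, z i ∈ Set.Ico (a * (y i : ℝ)) (a * (y i : ℝ) + a)}.indicator (fun _ => g (a • siteToE y)) x =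
      a ^ d * ∑ y ∈ box d L, g (a • siteToE y) := by
  rw [integral_finsetSum _ fun y _ => integrable_cell_indicator ha y _, Finset.mul_sum]
  refine Finset.sum_congr rfl fun y _ => ?_
  rw [integral_indicator_const _ (measurableSet_cell a y), measureReal_def, volume_cell ha,
    ENNReal.toReal_ofReal (pow_nonneg ha _), smul_eq_mul]

/-- Pointwise value of the lattice step function: `g(a ⌊x/a⌋)` if `⌊x/a⌋ ∈ box d L`, else `0`
(a point lies in exactly one cell). [folklore] -/
theorem step_apply (g : EuclideanSpace ℝ (Fin d) → ℝ) {a : ℝ} (ha : 0 < a) (L : ℕ)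
    (x : EuclideanSpace ℝ (Fin d)) :
    ∑ y ∈ box d L, {z : EuclideanSpace ℝ (Fin d) |
      ∀ i, z i ∈ Set.Ico (a * (y i : ℝ)) (a * (y i : ℝ) + a)}.indicator (fun _ => g (a • siteToE y)) x =
      if (fun i => ⌊x i / a⌋) ∈ box d L then g (a • siteToE (fun i => ⌊x i / a⌋)) else 0 := by
  split_ifs with h
  · rw [Finset.sum_eq_single_of_mem _ h fun y _ hy =>
      Set.indicator_of_notMem (fun hx => hy ((mem_cell_iff ha).1 hx).symm) _]
    exact Set.indicator_of_mem (mem_cell_floor ha x) _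
  · refine Finset.sum_eq_zero fun y hy => Set.indicator_of_notMem (fun hx => h ?_) _
    rwa [(mem_cell_iff ha).1 hx]

/-- **Integrable majorant.** If `(1 + ‖z‖)^{d+1} |g z| ≤ M` then for meshes `0 < a ≤ 1` and all boxes the
value of the lattice step function at `x` is at most `M (d+1)^{d+1} (1 + ‖x‖)^{-(d+1)}`. [folklore] -/
theorem norm_step_le {g : EuclideanSpace ℝ (Fin d) → ℝ} {M : ℝ}
    (hM : ∀ z, (1 + ‖z‖) ^ (d + 1) * ‖g z‖ ≤ M) {a : ℝ} (ha : 0 < a) (ha1 : a ≤ 1) (L : ℕ)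
    (x : EuclideanSpace ℝ (Fin d)) :
    ‖if (fun i => ⌊x i / a⌋) ∈ box d L then g (a • siteToE (fun i => ⌊x i / a⌋)) else 0‖ ≤
      M * ((d : ℝ) + 1) ^ (d + 1) * ((1 + ‖x‖) ^ (d + 1))⁻¹ := by
  have hM0 : 0 ≤ M := le_trans (by positivity) (hM 0)
  split_ifs with h
  · set z := a • siteToE (fun i => ⌊x i / a⌋)
    have hxz : ‖x - z‖ ≤ d :=
      (norm_sub_floor_le ha x).trans (mul_le_of_le_one_right (Nat.cast_nonneg d) ha1)
    have h1 : 1 + ‖x‖ ≤ ((d : ℝ) + 1) * (1 + ‖z‖) := by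
      have h' := norm_le_norm_add_norm_sub' x z
      have h'' := mul_nonneg (Nat.cast_nonneg d : (0 : ℝ) ≤ d) (norm_nonneg z)
      linarith
    have h2 : (1 + ‖x‖) ^ (d + 1) ≤ ((d : ℝ) + 1) ^ (d + 1) * (1 + ‖z‖) ^ (d + 1) := by
      rw [← mul_pow]
      exact pow_le_pow_left₀ (by positivity) h1 _
    have hx : 0 < (1 + ‖x‖) ^ (d + 1) := by positivity
    rw [← div_eq_mul_inv, le_div_iff₀ hx]
    calc ‖g z‖ * (1 + ‖x‖) ^ (d + 1)
        ≤ ‖g z‖ * (((d : ℝ) + 1) ^ (d + 1) * (1 + ‖z‖) ^ (d + 1)) :=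
          mul_le_mul_of_nonneg_left h2 (norm_nonneg _)
      _ = (1 + ‖z‖) ^ (d + 1) * ‖g z‖ * ((d : ℝ) + 1) ^ (d + 1) := by ring
      _ ≤ M * ((d : ℝ) + 1) ^ (d + 1) :=
          mul_le_mul_of_nonneg_right (hM z) (by positivity)
  · rw [norm_zero]
    positivity

/-- The majorant `M (d+1)^{d+1} (1 + ‖x‖)^{-(d+1)}` is Lebesgue integrable on `ℝᵈ`. [folklore] -/
theorem integrable_majorant (M : ℝ) :
    Integrable (fun x : EuclideanSpace ℝ (Fin d) =>
      M * ((d : ℝ) + 1) ^ (d + 1) * ((1 + ‖x‖) ^ (d + 1))⁻¹) volume := by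
  have hr : (Module.finrank ℝ (EuclideanSpace ℝ (Fin d)) : ℝ) < ((d + 1 : ℕ) : ℝ) := by
    rw [finrank_euclideanSpace_fin]
    exact_mod_cast Nat.lt_succ_self d
  refine ((integrable_one_add_norm hr).const_mul (M * ((d : ℝ) + 1) ^ (d + 1))).congr
    (ae_of_all _ fun x => ?_)
  simp only
  rw [Real.rpow_neg (by positivity), Real.rpow_natCast]

/-! ## Convergence of the Riemann sums -/

/-- **Riemann sums over exploding fine boxes (any dimension).** For a Schwartz function `g` on `ℝᵈ`,
spacings `a_k > 0`, `a_k → 0`, and half-sides `L_k` with `a_k L_k → ∞`: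
`a_k^d Σ_{y ∈ box d L_k} g(a_k y) → ∫ g`. [folklore] -/
theorem tendsto_riemannSum_box (g : 𝓢(EuclideanSpace ℝ (Fin d), ℝ)) (a : ℕ → ℝ) (L : ℕ → ℕ)
    (ha : ∀ k, 0 < a k) (ha0 : Tendsto a atTop (𝓝 0))
    (haL : Tendsto (fun k => a k * L k) atTop atTop) :
    Tendsto (fun k => a k ^ d * ∑ y ∈ box d (L k), g (a k • siteToE y)) atTop (𝓝 (∫ x, g x)) := by
  obtain ⟨M, hM⟩ : ∃ M : ℝ, ∀ z : EuclideanSpace ℝ (Fin d), (1 + ‖z‖) ^ (d + 1) * ‖g z‖ ≤ M := by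
    refine ⟨2 ^ (d + 1) * (Finset.Iic (d + 1, 0)).sup (fun m => SchwartzMap.seminorm ℝ m.1 m.2) g,
      fun z => ?_⟩
    have h := SchwartzMap.one_add_le_sup_seminorm_apply (𝕜 := ℝ) (m := (d + 1, 0)) (k := d + 1)
      (n := 0) le_rfl le_rfl g z
    rwa [norm_iteratedFDeriv_zero] at h
  have hfun : (fun k => a k ^ d * ∑ y ∈ box d (L k), g (a k • siteToE y)) = fun k =>
      ∫ x : EuclideanSpace ℝ (Fin d), ∑ y ∈ box d (L k), {z : EuclideanSpace ℝ (Fin d) |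
        ∀ i, z i ∈ Set.Ico (a k * (y i : ℝ)) (a k * (y i : ℝ) + a k)}.indicator
          (fun _ => g (a k • siteToE y)) x :=
    funext fun k => (integral_step g (ha k).le (L k)).symm
  rw [hfun]
  refine tendsto_integral_filter_of_dominated_convergence
    (fun x => M * ((d : ℝ) + 1) ^ (d + 1) * ((1 + ‖x‖) ^ (d + 1))⁻¹) ?_ ?_ (integrable_majorant M) ?_
  · exact Eventually.of_forall fun k => (integrable_step g (ha k).le (L k)).aestronglyMeasurable
  · filter_upwards [ha0.eventually (eventually_le_nhds zero_lt_one)] with k hk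
    refine ae_of_all _ fun x => ?_
    rw [step_apply g (ha k)]
    exact norm_step_le hM (ha k) hk (L k) x
  · refine ae_of_all _ fun x => ?_
    have h1 : Tendsto (fun k => g (a k • siteToE (fun i => ⌊x i / a k⌋))) atTop (𝓝 (g x)) :=
      (g.continuous.tendsto x).comp (tendsto_smul_floor ha ha0 x)
    refine h1.congr' ?_
    filter_upwards [eventually_floor_mem_box ha haL x] with k hk
    rw [step_apply g (ha k), if_pos hk]

/-- **Riemann sums of a Schwartz function over the exploding fine boxes of a scheme converge to its
integral** (`d = 4`): for `g ∈ 𝓢(ℝ⁴)`, spacings `a_k > 0` with `a_k → 0` and torus half-sides `L_k` with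
`a_k L_k → ∞`, `a_k⁴ Σ_{y ∈ {-L_k,…,L_k}⁴} g(a_k y) → ∫ g` (Lebesgue measure on `EuclideanSpace ℝ (Fin 4)`).
Dominated convergence for the lattice step functions, see `tendsto_riemannSum_box`. [folklore] -/
theorem riemannSumBox : ∀ (g : SchwartzMap (EuclideanSpace ℝ (Fin 4)) ℝ) (a : ℕ → ℝ) (L : ℕ → ℕ), (∀ k, 0 < a k) → Filter.Tendsto a Filter.atTop (nhds 0) → Filter.Tendsto (fun k => a k * L k) Filter.atTop Filter.atTop → Filter.Tendsto (fun k => a k ^ 4 * ∑ y ∈ Literature.Probability.LatticeModels.box 4 (L k), g (a k • Literature.MathematicalPhysics.QuantumLattice.siteToE y)) Filter.atTop (nhds (∫ x, g x)) :=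
  fun g a L ha ha0 haL => tendsto_riemannSum_box g a L ha ha0 haL

end Summit.QuantumFields.YangMills.Theorems.NPointIsotropy.ComplexRotationBandlimit

end
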